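/-
Copyright (c) 2026. All rights reserved.
Released under Apache 2.0 license as described in the file LICENSE.
-/
import Literature.NumberTheory.ComplexMultiplication.DegenerateCMTypesElementaryAbelianNearBentTypes
import HarnessLib

/-!
# The stabiliser of a near-bent CM type has order `1` or `2`; order `2` means the type is the concatenation
# `f ‖ f` of a bent transversal of a hyperplane — the equality case `2·|Stab|·(rank − 1) = |G|` of the reflex bound

SETTING (tree `DegenerateCMTypesElementaryAbelianNearBentTypes`, `DegenerateCMTypesAbelianStabilizerIndexBound`;
T. Kubota [Kubota1965] §2, §4 Lemma 2; G. Shimura [Shimura1998] §8.4 Example (1), §32.10).  `G` a finite commutative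
group of exponent `2`, `ρ ∈ G`, `T ⊆ G` a CM type (`|T| = m = |G|/2`), `Ŝ_T(χ) = Σ_{t∈T} χ(t)`,
`rank(T) = 1 + #{χ odd : Ŝ_T(χ) ≠ 0}` (Kubota), `Stab(T) = {g : Tg = T}` the stabiliser — on the CM field,
`Gal(K/K*)` with `K*` the reflex field, so that `[K* : ℚ] = [G : Stab(T)]`.  The tree proved the REFLEX BOUND
`2·|Stab(T)|·(rank(T) − 1) ≤ |G|` (`AbelianStabilizer.two_mul_card_stabilizer_mul_typeRank_sub_one_le`; Shimura
§32.10: `rank ≤ [K* : ℚ]/2 + 1`) with EQUALITY iff every odd character trivial on `Stab(T)` survives, i.e. iff `T` is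
induced from a NONDEGENERATE type of `G/Stab(T)` (`two_mul_card_stabilizer_mul_eq_iff`) — on the field side the
equality case is Hazama's «`Bᵐ(Aⁿ) = Dᵐ(Aⁿ)` for all `n, m`» and the strict case produces exceptional Hodge classes on
some power (tree `Pohlmann1968/CMTypeRankStabilizerBoundHazamaCriterion`, `…/AbelianCMFieldStabilizerCharacterCriterion`).
`T` is NEAR-BENT when `Ŝ_T(χ) = 0` or `Ŝ_T(χ)² = 2m` for every odd `χ` (C. Carlet [Carlet2020] §6.2.4: semi-bent =
near-bent functions, odd dimension; tree `NearBentTypes`: `rank(T) = m/2 + 1`, existence in every order `4ᵏ⁺¹` by the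
bent concatenation `x_n f ⊕ (x_n ⊕ 1) g` of [Carlet2020] §3.1 p. 81).  A function `h(x, x_n) = f(x)` not depending on
`x_n` has the LINEAR STRUCTURE `e_n` ([Carlet2020] §3.1.4 Definition 25: «`D_e f` constant»; Proposition 29: the
functions admitting `e` as a `0`-linear structure are those of the form `g ∘ L` with `g` independent of one
coordinate); for graphs, a linear structure `e` of `f` with `D_e f = 0` is a non-trivial element of `Stab(T)`.
THIS FILE proves, for near-bent CM types:

> **Theorem** (`card_stabilizer_le_two`, `card_stabilizer_eq_one_or_two`).  **`|Stab(T)| ∈ {1, 2}`** (the reflex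
> bound with `rank − 1 = m/2`: `|Stab|·m ≤ 2m`).
> **Theorem** (`two_mul_card_stabilizer_mul_eq_iff_card_eq_two`, `…_lt_iff_card_eq_one`).  **The reflex bound is an
> equality iff `|Stab(T)| = 2`, strict iff `|Stab(T)| = 1` (`T` primitive)** — near-bent types sit exactly on the
> boundary between Hazama's two cases.
> **Theorem** (`stabilizer_eq_pair`, `sum_char_ne_zero_of_apply_eq_one`, `sq_sum_filter_eq_card`,
> `eq_union_image`).  If `Tg = T` for some `g ≠ 1` then `Stab(T) = {1, g}`, the surviving odd characters are EXACTLY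
> those with `χ(g) = 1`, and for every even `θ` with `θ(g) = −1` the half `A = T ∩ ker θ` is a bent transversal of
> `⟨ρ⟩` in `ker θ` (`(Σ_A χ)² = |A|` for every odd `χ`) with **`T = A ∪ A·g`** — the imprimitive near-bent types are
> precisely the concatenations `f ‖ f` (the graph of a bent `f` of `n − 1` variables read in `n` variables, `g` its
> linear structure).
> **Theorem** (`forall_mul_mem_iff_union_image`, `exists_nearBent_stabilizer_eq_pair`).  Conversely `A ∪ A·a` (with
> `A` a bent transversal of `⟨ρ⟩` in `ker θ`, `θ(a) = −1`) is a near-bent CM type with `Stab = {1, a}`; such types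
> exist in every order `4ᵏ⁺¹`.
> **Theorem** (`card_stabilizer_eq_two_of_card_eq_four`, `card_stabilizer_eq_two_of_card_eq_sixteen`,
> `sixtyFour_le_card_of_card_stabilizer_eq_one`).  In orders `4` and `16` EVERY near-bent type has `|Stab| = 2`
> (order `16`: rank `5` forces `|G| ≤ 8|Stab|`, tree); hence **a primitive near-bent type needs `|G| ≥ 64`** (five
> Boolean variables).

* §0 helpers.
* §1 **`card_stabilizer_le_two`**, `card_stabilizer_eq_one_or_two`, **`two_mul_card_stabilizer_mul_eq_iff_card_eq_two`**,
  `two_mul_card_stabilizer_mul_lt_iff_card_eq_one`.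
* §2 imprimitive near-bent types: `filter_eq_image_filter_of_forall_mul_mem_iff` (any `T` with `Tg = T`),
  **`stabilizer_eq_pair`**, **`sum_char_ne_zero_of_apply_eq_one`**, `sum_char_eq_zero_of_apply_eq_neg_one`,
  **`sq_sum_filter_eq_card`**, **`eq_union_image`**.
* §3 the construction: `isCMTypeWith_union_image`, **`forall_mul_mem_iff_union_image`**,
  **`exists_nearBent_stabilizer_eq_pair`**.
* §4 orders `4`, `16`, and `64 ≤ |G|` for primitive near-bent types.

HONEST SCOPE.  The sources print the reflex bound (Shimura), Kubota's rank formula, the notion of linear structure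
and the semi-bent/near-bent notions for Boolean functions; the statements about `Stab(T)` of a near-bent CM type are
this file's combination of the tree's reflex bound with `rank = m/2 + 1`, not numbered results of the sources.  The
Hodge-theoretic reading (equality = all powers without exceptional classes, strict = exceptional classes on some power)
is the tree's field-level theory and is only quoted here, not re-proved; no primitive near-bent type is constructed
(their existence in order `64` is not claimed).  THEOREMS ONLY: no definition, no named fact, no instance, no `sorry`.

## References

* [Shimura1998] G. Shimura, *Abelian Varieties with Complex Multiplication and Modular Functions*, Princeton (1998),
  §8.4 Example (1) (stabiliser and reflex field), §32.10 (the reflex bound).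
* [Kubota1965] T. Kubota, *On the field extension by complex multiplication*, Trans. AMS 118 (1965), §2, §4 Lemma 2.
* [Carlet2020] C. Carlet, *Boolean Functions for Cryptography and Coding Theory*, CUP (2020), §6.2.4 (near-bent
  functions), §3.1 p. 81 (bent concatenation), §3.1.4 Definition 25 and Proposition 29 (linear structures).
* [Dodson1984] B. Dodson, *The structure of Galois groups of CM-fields*, Trans. AMS 283 (1984), §3.1.1.

## Provenance

Lane `lit-hodgefound` (Track 2, Layer A3), seat `lit-hodgefound-p10` generation 43, row g43-#4; neighbours cited by
name, nothing restated: `DegenerateCMTypesElementaryAbelianNearBentTypes` (g43-#3: `two_mul_typeRank_eq`,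
`two_mul_card_filter_even_eq`, `nearBent_union`, `nearBent_iff_typeRank_eq_five_of_card_eq_sixteen`, `isSquare_card`,
`nearBent_of_card_eq_four`, USED), `DegenerateCMTypesAbelianStabilizerIndexBound`
(`AbelianStabilizer.two_mul_card_stabilizer_mul_typeRank_sub_one_le`, `two_mul_card_stabilizer_mul_eq_iff`,
`card_stabilizer_pos`, `one_mem_stabilizer`, USED), `DegenerateCMTypesElementaryAbelianStabilizerRank`
(`card_le_eight_mul_card_filter_forall_mul_mem_iff_of_typeRank_eq_five`, USED), `DegenerateCMTypesElementaryAbelianBentTypesExistence`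
(g43-#2: `exists_subset_filter_forall_sq_eq`, USED), `DegenerateCMTypesElementaryAbelianBentTypes`
(`isCMTypeWith_of_forall_mul_not_mem`, USED), `DegenerateCMTypesElementaryAbelianBentTypesDecomposition`
(`two_mul_sum_filter_eq_add`, `two_mul_sum_filter_eq_sub`, USED), Mathlib `IsPGroup.iff_card`, `Nat.dvd_prime_pow`.
-/

open scoped BigOperators Classical

namespace Literature.NumberTheory.ComplexMultiplication

namespace CyclicCMType

namespace ExponentTwo

namespace NearBentTypesStabilizer

open AbelianStabilizer (two_mul_card_stabilizer_mul_typeRank_sub_one_le two_mul_card_stabilizer_mul_eq_iff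
  card_stabilizer_pos one_mem_stabilizer)
open BentTypes (isCMTypeWith_of_forall_mul_not_mem)
open BentTypesDecomposition (two_mul_sum_filter_eq_add two_mul_sum_filter_eq_sub)
open BentTypesExistence (exists_subset_filter_forall_sq_eq)
open NearBentTypes (two_mul_typeRank_eq two_mul_card_filter_even_eq nearBent_union
  nearBent_iff_typeRank_eq_five_of_card_eq_sixteen isSquare_card nearBent_of_card_eq_four)

variable {G : Type*} [CommGroup G] [Fintype G] [DecidableEq G] {ρ : G} {T : Finset G}

/-! ## §0 Helpers -/

section Helpers

omit [Fintype G] [DecidableEq G] in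
/-- `g·g = 1` in exponent `2`. [folklore] -/
private theorem mul_self_eq_one_ns (hexp : ∀ g : G, g ^ 2 = 1) (g : G) : g * g = 1 := by
  rw [← pow_two]; exact hexp g

omit [Fintype G] [DecidableEq G] in
/-- Characters of a group of exponent `2` are `±1`-valued. [folklore] -/
private theorem char_eq_one_or_ns (hexp : ∀ g : G, g ^ 2 = 1) (χ : AddChar (Additive G) ℂ) (g : G) :
    χ (Additive.ofMul g) = 1 ∨ χ (Additive.ofMul g) = -1 :=
  character_apply_eq_one_or_of_mul_self χ (mul_self_eq_one_ns hexp g)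

omit [Fintype G] [DecidableEq G] in
/-- `χ(gh) = χ(g)χ(h)`. [folklore] -/
private theorem char_mul_ns (χ : AddChar (Additive G) ℂ) (g h : G) :
    χ (Additive.ofMul (g * h)) = χ (Additive.ofMul g) * χ (Additive.ofMul h) := by
  rw [ofMul_mul, AddChar.map_add_eq_mul]

omit [Fintype G] [DecidableEq G] in
/-- `χ(g)² = 1`. [folklore] -/
private theorem char_sq_ns (hexp : ∀ g : G, g ^ 2 = 1) (χ : AddChar (Additive G) ℂ) (g : G) :
    χ (Additive.ofMul g) ^ 2 = 1 := by
  rcases char_eq_one_or_ns hexp χ g with h | h <;> rw [h] <;> norm_num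

omit [Fintype G] [DecidableEq G] in
/-- `χ(1) = 1`. [folklore] -/
private theorem char_one_ns (χ : AddChar (Additive G) ℂ) : χ (Additive.ofMul (1 : G)) = 1 := by
  rw [ofMul_one, AddChar.map_zero_eq_one]

omit [Fintype G] [DecidableEq G] in
/-- `ρx ∈ T ↔ x ∉ T` for a CM type. [folklore] -/
private theorem rho_mul_mem_iff_ns (h : IsCMTypeWith ρ (T : Set G)) (x : G) : ρ * x ∈ T ↔ x ∉ T := by
  have := h.rho_smul_mem_iff x
  simpa only [smul_eq_mul, Finset.mem_coe] using this

omit [DecidableEq G] in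
/-- `2|T| = |G|` for a CM type. [folklore] -/
private theorem two_mul_card_ns (h : IsCMTypeWith ρ (T : Set G)) : 2 * T.card = Fintype.card G := by
  have hρ2 : ρ * ρ = 1 := by
    have := h.invol (1 : G)
    simpa [smul_eq_mul] using this
  have hinj : Function.Injective fun s : G => ρ * s := fun a b hab => mul_left_cancel hab
  have hc : Tᶜ = T.image fun s => ρ * s := by
    ext x
    rw [Finset.mem_compl, Finset.mem_image]
    constructor
    · intro hx
      refine ⟨ρ * x, (rho_mul_mem_iff_ns h x).2 hx, ?_⟩
      show ρ * (ρ * x) = x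
      rw [← mul_assoc, hρ2, one_mul]
    · rintro ⟨s, hs, rfl⟩
      exact fun hx => ((rho_mul_mem_iff_ns h s).1 hx) hs
  have h1 : Tᶜ.card = T.card := by rw [hc, Finset.card_image_of_injective _ hinj]
  have h2 := Finset.card_add_card_compl T
  omega

omit [DecidableEq G] in
/-- `|T| > 0` for a CM type. [folklore] -/
private theorem card_pos_ns (h : IsCMTypeWith ρ (T : Set G)) : 0 < T.card := by
  have := two_mul_card_ns h
  have : 0 < Fintype.card G := Fintype.card_pos
  omega

omit [Fintype G] [DecidableEq G] in
/-- A stabilising element differs from `ρ` (`Tρ = G ∖ T ≠ T`). [folklore] -/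
private theorem ne_rho_of_forall_mul_mem_iff_ns (h : IsCMTypeWith ρ (T : Set G)) {g : G}
    (hg : ∀ t : G, t * g ∈ T ↔ t ∈ T) (hT : T.Nonempty) : g ≠ ρ := by
  rintro rfl
  obtain ⟨t, ht⟩ := hT
  have := (hg t).2 ht
  rw [mul_comm] at this
  exact (rho_mul_mem_iff_ns h t).1 this ht

omit [Fintype G] [DecidableEq G] in
/-- `Ŝ = P + N` along an even character `θ` (tree `two_mul_sum_filter_eq_add/sub`).
[cite: Carlet2020, §6.1.17 Theorem 16 (proof)] -/
private theorem sum_eq_add_ns (hexp : ∀ g : G, g ^ 2 = 1) (T : Finset G) (χ θ : AddChar (Additive G) ℂ) :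
    ∑ t ∈ T, χ (Additive.ofMul t) =
      ∑ t ∈ T.filter (fun t => θ (Additive.ofMul t) = 1), χ (Additive.ofMul t) +
        ∑ t ∈ T.filter (fun t => θ (Additive.ofMul t) = -1), χ (Additive.ofMul t) := by
  have hP := two_mul_sum_filter_eq_add hexp T χ θ
  have hN := two_mul_sum_filter_eq_sub hexp T χ θ
  linear_combination -(hP + hN) / 2

omit [Fintype G] in
/-- Character sums over a translate: `Σ_{x∈S·c} χ(x) = χ(c)·Σ_{s∈S} χ(s)`. [folklore] -/
private theorem sum_char_image_mul_ns (χ : AddChar (Additive G) ℂ) (S : Finset G) (c : G) :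
    ∑ x ∈ S.image (fun s => s * c), χ (Additive.ofMul x) = χ (Additive.ofMul c) * ∑ s ∈ S, χ (Additive.ofMul s) := by
  rw [Finset.sum_image fun a _ b _ hab => mul_right_cancel hab, Finset.mul_sum]
  exact Finset.sum_congr rfl fun s _ => by rw [char_mul_ns, mul_comm]

end Helpers

/-! ## §1 The stabiliser of a near-bent type has order `1` or `2` -/

section Order

/-- **`|Stab(T)| ≤ 2` FOR A NEAR-BENT CM TYPE**: the reflex bound `2·|Stab|·(rank − 1) ≤ |G| = 2m` with
`rank − 1 = m/2` reads `|Stab|·m ≤ 2m`. [cite: Shimura1998, §32.10] [cite: Kubota1965, §4 Lemma 2]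
[cite: Carlet2020, §6.2.4] -/
theorem card_stabilizer_le_two (hexp : ∀ g : G, g ^ 2 = 1) (h : IsCMTypeWith ρ (T : Set G))
    (hnb : ∀ χ : AddChar (Additive G) ℂ, χ (Additive.ofMul ρ) = -1 →
      ∑ t ∈ T, χ (Additive.ofMul t) = 0 ∨ (∑ t ∈ T, χ (Additive.ofMul t)) ^ 2 = 2 * (T.card : ℂ)) :
    (Finset.univ.filter fun g : G => ∀ t : G, t * g ∈ T ↔ t ∈ T).card ≤ 2 := by
  have hb := two_mul_card_stabilizer_mul_typeRank_sub_one_le h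
  have hr := two_mul_typeRank_eq hexp h hnb
  have hm := two_mul_card_ns h
  have hpos := card_pos_ns h
  set S := (Finset.univ.filter fun g : G => ∀ t : G, t * g ∈ T ↔ t ∈ T).card with hS
  have h2 : 2 * (typeRank G (T : Set G) - 1) = T.card := by omega
  have key : S * T.card ≤ 2 * T.card := by
    calc S * T.card = 2 * S * (typeRank G (T : Set G) - 1) := by rw [← h2]; ring
      _ ≤ Fintype.card G := hb
      _ = 2 * T.card := hm.symm
  exact Nat.le_of_mul_le_mul_right key hpos

/-- **`|Stab(T)| = 1` OR `|Stab(T)| = 2`** for a near-bent type. [cite: Shimura1998, §32.10] [cite: Kubota1965, §4 Lemma 2] -/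
theorem card_stabilizer_eq_one_or_two (hexp : ∀ g : G, g ^ 2 = 1) (h : IsCMTypeWith ρ (T : Set G))
    (hnb : ∀ χ : AddChar (Additive G) ℂ, χ (Additive.ofMul ρ) = -1 →
      ∑ t ∈ T, χ (Additive.ofMul t) = 0 ∨ (∑ t ∈ T, χ (Additive.ofMul t)) ^ 2 = 2 * (T.card : ℂ)) :
    (Finset.univ.filter fun g : G => ∀ t : G, t * g ∈ T ↔ t ∈ T).card = 1 ∨
      (Finset.univ.filter fun g : G => ∀ t : G, t * g ∈ T ↔ t ∈ T).card = 2 := by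
  have h1 := card_stabilizer_le_two hexp h hnb
  have h2 := card_stabilizer_pos T
  omega

/-- **THE REFLEX BOUND IS AN EQUALITY IFF `|Stab(T)| = 2`** (near-bent `T`): `2·|Stab|·(rank − 1) = |Stab|·m` equals
`|G| = 2m` iff `|Stab| = 2` — the equality case is «`T` induced from a nondegenerate type of `G/Stab(T)`» (tree
`two_mul_card_stabilizer_mul_eq_iff`), on the field side Hazama's case `Bᵐ(Aⁿ) = Dᵐ(Aⁿ)` for all `n, m`.
[cite: Shimura1998, §32.10] [cite: Kubota1965, §4 Lemma 2] -/
theorem two_mul_card_stabilizer_mul_eq_iff_card_eq_two (hexp : ∀ g : G, g ^ 2 = 1)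
    (h : IsCMTypeWith ρ (T : Set G))
    (hnb : ∀ χ : AddChar (Additive G) ℂ, χ (Additive.ofMul ρ) = -1 →
      ∑ t ∈ T, χ (Additive.ofMul t) = 0 ∨ (∑ t ∈ T, χ (Additive.ofMul t)) ^ 2 = 2 * (T.card : ℂ)) :
    2 * (Finset.univ.filter fun g : G => ∀ t : G, t * g ∈ T ↔ t ∈ T).card * (typeRank G (T : Set G) - 1) =
      Fintype.card G ↔ (Finset.univ.filter fun g : G => ∀ t : G, t * g ∈ T ↔ t ∈ T).card = 2 := by
  have hr := two_mul_typeRank_eq hexp h hnb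
  have hm := two_mul_card_ns h
  have hpos := card_pos_ns h
  have h12 := card_stabilizer_eq_one_or_two hexp h hnb
  set S := (Finset.univ.filter fun g : G => ∀ t : G, t * g ∈ T ↔ t ∈ T).card with hS
  have h2 : 2 * (typeRank G (T : Set G) - 1) = T.card := by omega
  have hkey : 2 * S * (typeRank G (T : Set G) - 1) = S * T.card := by rw [← h2]; ring
  rw [hkey, ← hm]
  constructor
  · intro heq
    exact Nat.eq_of_mul_eq_mul_right hpos heq
  · intro hS2
    rw [hS2]

/-- **THE REFLEX BOUND IS STRICT IFF `|Stab(T)| = 1`** (near-bent `T` primitive: trivial stabiliser) — on the field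
side the case of exceptional Hodge classes on some power `Aⁿ` (tree `Pohlmann1968/CMTypeRankStabilizerBoundHazamaCriterion`).
[cite: Shimura1998, §32.10] [cite: Kubota1965, §4 Lemma 2] -/
theorem two_mul_card_stabilizer_mul_lt_iff_card_eq_one (hexp : ∀ g : G, g ^ 2 = 1)
    (h : IsCMTypeWith ρ (T : Set G))
    (hnb : ∀ χ : AddChar (Additive G) ℂ, χ (Additive.ofMul ρ) = -1 →
      ∑ t ∈ T, χ (Additive.ofMul t) = 0 ∨ (∑ t ∈ T, χ (Additive.ofMul t)) ^ 2 = 2 * (T.card : ℂ)) :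
    2 * (Finset.univ.filter fun g : G => ∀ t : G, t * g ∈ T ↔ t ∈ T).card * (typeRank G (T : Set G) - 1) <
      Fintype.card G ↔ (Finset.univ.filter fun g : G => ∀ t : G, t * g ∈ T ↔ t ∈ T).card = 1 := by
  have hle := two_mul_card_stabilizer_mul_typeRank_sub_one_le h
  have heq := two_mul_card_stabilizer_mul_eq_iff_card_eq_two hexp h hnb
  have h12 := card_stabilizer_eq_one_or_two hexp h hnb
  constructor
  · intro hlt
    rcases h12 with h1 | h2
    · exact h1
    · exact absurd (heq.2 h2) hlt.ne
  · intro h1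
    refine lt_of_le_of_ne hle fun he => ?_
    have := heq.1 he
    omega

end Order

/-! ## §2 Imprimitive near-bent types are the concatenations `f ‖ f` -/

section Imprimitive

omit [Fintype G] in
/-- **A STABILISING `g` WITH `θ(g) = −1` SWAPS THE TWO HALVES**: if `Tg = T` and `θ(g) = −1` then
`T ∖ ker θ = (T ∩ ker θ)·g` (every finset `T`). [cite: Carlet2020, §3.1.4 Proposition 29] [cite: Kubota1965, §2] -/
theorem filter_eq_image_filter_of_forall_mul_mem_iff (hexp : ∀ g : G, g ^ 2 = 1) {g : G}
    (hg : ∀ t : G, t * g ∈ T ↔ t ∈ T) {θ : AddChar (Additive G) ℂ} (hθg : θ (Additive.ofMul g) = -1) :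
    T.filter (fun t => θ (Additive.ofMul t) = -1) =
      (T.filter fun t => θ (Additive.ofMul t) = 1).image fun s => s * g := by
  ext t
  simp only [Finset.mem_filter, Finset.mem_image]
  constructor
  · rintro ⟨ht, hθt⟩
    refine ⟨t * g, ⟨(hg t).2 ht, ?_⟩, ?_⟩
    · rw [char_mul_ns, hθt, hθg]
      norm_num
    · rw [mul_assoc, mul_self_eq_one_ns hexp g, mul_one]
  · rintro ⟨s, ⟨hs, hθs⟩, rfl⟩
    exact ⟨(hg s).2 hs, by rw [char_mul_ns, hθs, hθg, one_mul]⟩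

/-- **`Stab(T) = {1, g}`** for a near-bent type stabilised by `g ≠ 1` (`|Stab| ≤ 2`).
[cite: Shimura1998, §32.10] [cite: Kubota1965, §2] -/
theorem stabilizer_eq_pair (hexp : ∀ g : G, g ^ 2 = 1) (h : IsCMTypeWith ρ (T : Set G))
    (hnb : ∀ χ : AddChar (Additive G) ℂ, χ (Additive.ofMul ρ) = -1 →
      ∑ t ∈ T, χ (Additive.ofMul t) = 0 ∨ (∑ t ∈ T, χ (Additive.ofMul t)) ^ 2 = 2 * (T.card : ℂ))
    {g : G} (hg1 : g ≠ 1) (hg : ∀ t : G, t * g ∈ T ↔ t ∈ T) :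
    (Finset.univ.filter fun x : G => ∀ t : G, t * x ∈ T ↔ t ∈ T) = {1, g} := by
  symm
  apply Finset.eq_of_subset_of_card_le
  · intro x hx
    rcases Finset.mem_insert.1 hx with rfl | hx
    · exact one_mem_stabilizer T
    · rw [Finset.mem_singleton.1 hx]
      exact Finset.mem_filter.2 ⟨Finset.mem_univ _, hg⟩
  · rw [Finset.card_pair hg1.symm]
    exact card_stabilizer_le_two hexp h hnb

/-- `|Stab(T)| = 2` for a near-bent type stabilised by some `g ≠ 1`. [cite: Shimura1998, §32.10] [cite: Kubota1965, §2] -/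
theorem card_stabilizer_eq_two_of_forall_mul_mem_iff (hexp : ∀ g : G, g ^ 2 = 1) (h : IsCMTypeWith ρ (T : Set G))
    (hnb : ∀ χ : AddChar (Additive G) ℂ, χ (Additive.ofMul ρ) = -1 →
      ∑ t ∈ T, χ (Additive.ofMul t) = 0 ∨ (∑ t ∈ T, χ (Additive.ofMul t)) ^ 2 = 2 * (T.card : ℂ))
    {g : G} (hg1 : g ≠ 1) (hg : ∀ t : G, t * g ∈ T ↔ t ∈ T) :
    (Finset.univ.filter fun x : G => ∀ t : G, t * x ∈ T ↔ t ∈ T).card = 2 := by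
  rw [stabilizer_eq_pair hexp h hnb hg1 hg, Finset.card_pair hg1.symm]

/-- **THE SURVIVORS OF AN IMPRIMITIVE NEAR-BENT TYPE ARE EXACTLY THE ODD `χ` WITH `χ(g) = 1`** (`Tg = T`, `g ≠ 1`):
the equality case of the reflex bound — every odd character trivial on `Stab(T) = {1, g}` survives.
[cite: Shimura1998, §32.10] [cite: Kubota1965, §4 Lemma 2] -/
theorem sum_char_ne_zero_of_apply_eq_one (hexp : ∀ g : G, g ^ 2 = 1) (h : IsCMTypeWith ρ (T : Set G))
    (hnb : ∀ χ : AddChar (Additive G) ℂ, χ (Additive.ofMul ρ) = -1 →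
      ∑ t ∈ T, χ (Additive.ofMul t) = 0 ∨ (∑ t ∈ T, χ (Additive.ofMul t)) ^ 2 = 2 * (T.card : ℂ))
    {g : G} (hg1 : g ≠ 1) (hg : ∀ t : G, t * g ∈ T ↔ t ∈ T)
    {χ : AddChar (Additive G) ℂ} (hχ : χ (Additive.ofMul ρ) = -1) (hχg : χ (Additive.ofMul g) = 1) :
    ∑ t ∈ T, χ (Additive.ofMul t) ≠ 0 := by
  have hS2 := card_stabilizer_eq_two_of_forall_mul_mem_iff hexp h hnb hg1 hg
  have heq := (two_mul_card_stabilizer_mul_eq_iff_card_eq_two hexp h hnb).2 hS2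
  refine (two_mul_card_stabilizer_mul_eq_iff h).1 heq χ hχ fun s hs => ?_
  have hs' : s ∈ (Finset.univ.filter fun x : G => ∀ t : G, t * x ∈ T ↔ t ∈ T) :=
    Finset.mem_filter.2 ⟨Finset.mem_univ _, hs⟩
  rw [stabilizer_eq_pair hexp h hnb hg1 hg, Finset.mem_insert, Finset.mem_singleton] at hs'
  rcases hs' with rfl | rfl
  · exact char_one_ns χ
  · exact hχg

omit [Fintype G] in
/-- … and the odd `χ` with `χ(g) = −1` vanish on `T` (`Ŝ(χ) = χ(g)·Ŝ(χ)` since `Tg = T`).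
[cite: Kubota1965, §4 Lemma 2] -/
theorem sum_char_eq_zero_of_apply_eq_neg_one (hexp : ∀ g : G, g ^ 2 = 1) {g : G}
    (hg : ∀ t : G, t * g ∈ T ↔ t ∈ T) {χ : AddChar (Additive G) ℂ} (hχg : χ (Additive.ofMul g) = -1) :
    ∑ t ∈ T, χ (Additive.ofMul t) = 0 := by
  have himage : T.image (fun s => s * g) = T := by
    ext x
    rw [Finset.mem_image]
    constructor
    · rintro ⟨s, hs, rfl⟩
      exact (hg s).2 hs
    · intro hx
      exact ⟨x * g, (hg x).2 hx, by rw [mul_assoc, mul_self_eq_one_ns hexp g, mul_one]⟩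
  have h1 := sum_char_image_mul_ns χ T g
  rw [himage, hχg] at h1
  linear_combination h1 / 2

/-- **THE HALF `A = T ∩ ker θ` OF AN IMPRIMITIVE NEAR-BENT TYPE IS BENT**: if `T` is near-bent, `Tg = T` with `g ≠ 1`
and `θ` is an even character with `θ(g) = −1`, then `(Σ_{t ∈ T, θ(t) = 1} χ(t))² = #{t ∈ T : θ(t) = 1}` (`= m/2`)
for every odd `χ` — for `χ(g) = 1`: `Ŝ_T(χ) = (1 + χ(g))·Σ_A χ = 2Σ_A χ ≠ 0`, so `4(Σ_A χ)² = 2m`; for `χ(g) = −1`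
pass to `χθ`.  The function `f` of which `T` is the graph `f ‖ f` is bent. [cite: Carlet2020, §6.2.4 and §3.1 p. 81]
[cite: Kubota1965, §4 Lemma 2] -/
theorem sq_sum_filter_eq_card (hexp : ∀ g : G, g ^ 2 = 1) (h : IsCMTypeWith ρ (T : Set G))
    (hnb : ∀ χ : AddChar (Additive G) ℂ, χ (Additive.ofMul ρ) = -1 →
      ∑ t ∈ T, χ (Additive.ofMul t) = 0 ∨ (∑ t ∈ T, χ (Additive.ofMul t)) ^ 2 = 2 * (T.card : ℂ))
    {g : G} (hg1 : g ≠ 1) (hg : ∀ t : G, t * g ∈ T ↔ t ∈ T)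
    {θ : AddChar (Additive G) ℂ} (hθ : θ (Additive.ofMul ρ) = 1) (hθg : θ (Additive.ofMul g) = -1) :
    ∀ χ : AddChar (Additive G) ℂ, χ (Additive.ofMul ρ) = -1 →
      (∑ t ∈ T.filter (fun t => θ (Additive.ofMul t) = 1), χ (Additive.ofMul t)) ^ 2 =
        ((T.filter fun t => θ (Additive.ofMul t) = 1).card : ℂ) := by
  have hθ0 : θ ≠ 0 := by
    intro h0
    rw [h0, AddChar.zero_apply] at hθg
    norm_num at hθg
  obtain ⟨hK, -⟩ := two_mul_card_filter_even_eq hexp h hθ hθ0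
  have hKc : (((T.filter fun t => θ (Additive.ofMul t) = 1).card : ℕ) : ℂ) * 2 = T.card := by
    have e := congrArg (fun n : ℕ => (n : ℂ)) hK
    push_cast at e
    linear_combination e
  have himg := filter_eq_image_filter_of_forall_mul_mem_iff hexp hg hθg
  -- first the characters with `χ(g) = 1`
  have main : ∀ χ : AddChar (Additive G) ℂ, χ (Additive.ofMul ρ) = -1 → χ (Additive.ofMul g) = 1 →
      (∑ t ∈ T.filter (fun t => θ (Additive.ofMul t) = 1), χ (Additive.ofMul t)) ^ 2 =
        ((T.filter fun t => θ (Additive.ofMul t) = 1).card : ℂ) := by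
    intro χ hχ hχg
    have hne := sum_char_ne_zero_of_apply_eq_one hexp h hnb hg1 hg hχ hχg
    have h2 := (hnb χ hχ).resolve_left hne
    have hS : ∑ t ∈ T, χ (Additive.ofMul t) =
        2 * ∑ t ∈ T.filter (fun t => θ (Additive.ofMul t) = 1), χ (Additive.ofMul t) := by
      rw [sum_eq_add_ns hexp T χ θ, himg, sum_char_image_mul_ns, hχg]
      ring
    rw [hS] at h2
    linear_combination h2 / 4 - hKc / 2
  intro χ hχ
  rcases char_eq_one_or_ns hexp χ g with hχg | hχg
  · exact main χ hχ hχg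
  · -- pass to `χθ`: odd, `(χθ)(g) = 1`, same sum on `A ⊆ ker θ`
    have hχθ : (χ + θ) (Additive.ofMul ρ) = -1 := by rw [AddChar.add_apply, hχ, hθ, mul_one]
    have hχθg : (χ + θ) (Additive.ofMul g) = 1 := by rw [AddChar.add_apply, hχg, hθg]; norm_num
    have hsame : ∑ t ∈ T.filter (fun t => θ (Additive.ofMul t) = 1), (χ + θ) (Additive.ofMul t) =
        ∑ t ∈ T.filter (fun t => θ (Additive.ofMul t) = 1), χ (Additive.ofMul t) :=
      Finset.sum_congr rfl fun t ht => by rw [AddChar.add_apply, (Finset.mem_filter.1 ht).2, mul_one]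
    rw [← hsame]
    exact main (χ + θ) hχθ hχθg

omit [Fintype G] in
/-- **`T = A ∪ A·g`: AN IMPRIMITIVE NEAR-BENT TYPE IS THE CONCATENATION `f ‖ f`** of the bent transversal
`A = T ∩ ker θ` of `⟨ρ⟩` in the hyperplane `ker θ ∌ g` (any even `θ` with `θ(g) = −1`) — the graph of a bent function of
`n − 1` variables read in `n` variables, `g` its `0`-linear structure. [cite: Carlet2020, §3.1.4 Proposition 29 and §3.1 p. 81]
[cite: Kubota1965, §2] -/
theorem eq_union_image (hexp : ∀ g : G, g ^ 2 = 1) {g : G} (hg : ∀ t : G, t * g ∈ T ↔ t ∈ T)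
    {θ : AddChar (Additive G) ℂ} (hθg : θ (Additive.ofMul g) = -1) :
    T = T.filter (fun t => θ (Additive.ofMul t) = 1) ∪
      (T.filter fun t => θ (Additive.ofMul t) = 1).image fun s => s * g := by
  rw [← filter_eq_image_filter_of_forall_mul_mem_iff hexp hg hθg]
  ext t
  simp only [Finset.mem_union, Finset.mem_filter]
  constructor
  · intro ht
    rcases char_eq_one_or_ns hexp θ t with h1 | h1
    · exact Or.inl ⟨ht, h1⟩
    · exact Or.inr ⟨ht, h1⟩
  · rintro (⟨ht, -⟩ | ⟨ht, -⟩) <;> exact ht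

end Imprimitive

/-! ## §3 The construction `A ∪ A·a`: a near-bent type with stabiliser `{1, a}` -/

section Construction

omit [Fintype G] in
/-- `A ∪ A·a` is `ρ`-free when `A ⊆ ker θ` is `ρ`-free, `θ` even, `θ(a) = −1`. [folklore] -/
private theorem union_rho_free_ns {A : Finset G} {θ : AddChar (Additive G) ℂ}
    (hθ : θ (Additive.ofMul ρ) = 1) {a : G} (hθa : θ (Additive.ofMul a) = -1)
    (hAθ : ∀ x ∈ A, θ (Additive.ofMul x) = 1) (hAρ : ∀ x ∈ A, x * ρ ∉ A) :
    ∀ t ∈ A ∪ A.image (fun s => s * a), t * ρ ∉ A ∪ A.image (fun s => s * a) := by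
  have hBθ : ∀ b ∈ A.image (fun s => s * a), θ (Additive.ofMul b) = -1 := by
    intro b hb
    obtain ⟨x, hx, rfl⟩ := Finset.mem_image.1 hb
    rw [char_mul_ns, hAθ x hx, hθa, one_mul]
  intro t ht htρ
  rcases Finset.mem_union.1 ht with htA | htB
  · rcases Finset.mem_union.1 htρ with h1 | h1
    · exact hAρ t htA h1
    · have e := hBθ _ h1
      rw [char_mul_ns, hAθ t htA, hθ, one_mul] at e
      norm_num at e
  · obtain ⟨x, hx, rfl⟩ := Finset.mem_image.1 htB
    rcases Finset.mem_union.1 htρ with h1 | h1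
    · have e := hAθ _ h1
      rw [char_mul_ns, char_mul_ns, hAθ x hx, hθa, hθ] at e
      norm_num at e
    · obtain ⟨y, hy, hyx⟩ := Finset.mem_image.1 h1
      have hyx' : y = x * ρ := by
        apply mul_right_cancel (b := a)
        rw [hyx]
        simp only [mul_assoc, mul_comm ρ a]
      rw [hyx'] at hy
      exact hAρ x hx hy

/-- **`A ∪ A·a` IS A CM TYPE** when `A ⊆ ker θ` is a `ρ`-free set with `4|A| = |G|` (a transversal of `⟨ρ⟩` in the
index-`2` subgroup `ker θ ∋ ρ`), `θ` even and `θ(a) = −1`. [cite: Kubota1965, §2] [cite: Carlet2020, §3.1 p. 81] -/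
theorem isCMTypeWith_union_image (hexp : ∀ g : G, g ^ 2 = 1) {A : Finset G} {θ : AddChar (Additive G) ℂ}
    (hθ : θ (Additive.ofMul ρ) = 1) {a : G} (hθa : θ (Additive.ofMul a) = -1)
    (hAθ : ∀ x ∈ A, θ (Additive.ofMul x) = 1) (hAρ : ∀ x ∈ A, x * ρ ∉ A) (hAcard : 4 * A.card = Fintype.card G) :
    IsCMTypeWith ρ ((A ∪ A.image (fun s => s * a) : Finset G) : Set G) := by
  have hdisj : Disjoint A (A.image fun s => s * a) := by
    rw [Finset.disjoint_left]
    intro x hxA hxB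
    obtain ⟨y, hy, hyx⟩ := Finset.mem_image.1 hxB
    have e := hAθ x hxA
    rw [← hyx, char_mul_ns, hAθ y hy, hθa, one_mul] at e
    norm_num at e
  have hcard : 2 * (A ∪ A.image (fun s => s * a)).card = Fintype.card G := by
    rw [Finset.card_union_of_disjoint hdisj,
      Finset.card_image_of_injective _ (fun x y hxy => mul_right_cancel hxy), ← hAcard]
    ring
  exact isCMTypeWith_of_forall_mul_not_mem hexp hcard (union_rho_free_ns hθ hθa hAθ hAρ)

omit [Fintype G] in
/-- **`a` STABILISES `A ∪ A·a`** (`(A ∪ Aa)·a = Aa ∪ A`): the concatenation `f ‖ f` has the linear structure `a`.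
[cite: Carlet2020, §3.1.4 Proposition 29] [cite: Kubota1965, §2] -/
theorem forall_mul_mem_iff_union_image (hexp : ∀ g : G, g ^ 2 = 1) (A : Finset G) (a : G) :
    ∀ t : G, t * a ∈ A ∪ A.image (fun s => s * a) ↔ t ∈ A ∪ A.image (fun s => s * a) := by
  have haa : a * a = 1 := mul_self_eq_one_ns hexp a
  intro t
  simp only [Finset.mem_union, Finset.mem_image]
  constructor
  · rintro (h1 | ⟨s, hs, hst⟩)
    · exact Or.inr ⟨t * a, h1, by rw [mul_assoc, haa, mul_one]⟩
    · left
      have : s = t := mul_right_cancel hst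
      rw [← this]
      exact hs
  · rintro (h1 | ⟨s, hs, rfl⟩)
    · exact Or.inr ⟨t, h1, rfl⟩
    · left
      rw [mul_assoc, haa, mul_one]
      exact hs

/-- **NEAR-BENT CM TYPES WITH STABILISER OF ORDER `2` EXIST IN EVERY ORDER `4ᵏ⁺¹`**: `T = A ∪ A·a` for a bent
transversal `A` of `⟨ρ⟩` inside the kernel of an even `θ` with `θ(a) = −1` (tree `exists_subset_filter_forall_sq_eq`)
is a near-bent CM type with `Stab(T) = {1, a}` — the equality case `2·|Stab|·(rank − 1) = |G|` of the reflex bound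
(induced from the nondegenerate = bent type of `G/⟨a⟩`). [cite: Carlet2020, §3.1 p. 81 and §6.2.4]
[cite: Shimura1998, §32.10] [cite: Kubota1965, §4 Lemma 2] -/
theorem exists_nearBent_stabilizer_eq_pair (hexp : ∀ g : G, g ^ 2 = 1) (hρ1 : ρ ≠ 1) {k : ℕ}
    (hcard : Fintype.card G = 4 ^ (k + 1)) {θ : AddChar (Additive G) ℂ} (hθ : θ (Additive.ofMul ρ) = 1)
    {a : G} (hθa : θ (Additive.ofMul a) = -1) :
    ∃ T : Finset G, IsCMTypeWith ρ (T : Set G) ∧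
      (∀ χ : AddChar (Additive G) ℂ, χ (Additive.ofMul ρ) = -1 →
        ∑ t ∈ T, χ (Additive.ofMul t) = 0 ∨ (∑ t ∈ T, χ (Additive.ofMul t)) ^ 2 = 2 * (T.card : ℂ)) ∧
      (Finset.univ.filter fun x : G => ∀ t : G, t * x ∈ T ↔ t ∈ T) = {1, a} ∧
      2 * (Finset.univ.filter fun x : G => ∀ t : G, t * x ∈ T ↔ t ∈ T).card * (typeRank G (T : Set G) - 1) =
        Fintype.card G := by
  have hθ0 : θ ≠ 0 := by
    intro h0
    rw [h0, AddChar.zero_apply] at hθa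
    norm_num at hθa
  have ha1 : a ≠ 1 := by
    rintro rfl
    rw [char_one_ns] at hθa
    norm_num at hθa
  obtain ⟨A, hAK, hAρ, hAcard, hAbent⟩ := exists_subset_filter_forall_sq_eq hexp hρ1 hcard hθ hθ0
  have hAθ : ∀ x ∈ A, θ (Additive.ofMul x) = 1 := fun x hx => (Finset.mem_filter.1 (hAK hx)).2
  have hA4 : 4 * A.card = Fintype.card G := by rw [hAcard, hcard, pow_succ]; ring
  have hT := isCMTypeWith_union_image hexp hθ hθa hAθ hAρ hA4
  have hBθ : ∀ b ∈ A.image (fun s => s * a), θ (Additive.ofMul b) = -1 := by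
    intro b hb
    obtain ⟨x, hx, rfl⟩ := Finset.mem_image.1 hb
    rw [char_mul_ns, hAθ x hx, hθa, one_mul]
  have hBbent : ∀ χ : AddChar (Additive G) ℂ, χ (Additive.ofMul ρ) = -1 →
      (∑ b ∈ A.image (fun s => s * a), χ (Additive.ofMul b)) ^ 2 = ((A.image fun s => s * a).card : ℂ) := by
    intro χ hχ
    rw [sum_char_image_mul_ns, mul_pow, char_sq_ns hexp, one_mul, hAbent χ hχ,
      Finset.card_image_of_injective _ (fun x y hxy => mul_right_cancel hxy)]
  have hnb := nearBent_union hexp hT hθ hθ0 hAθ hBθ hAbent hBbent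
  have hstab := forall_mul_mem_iff_union_image hexp A a
  have hpair := stabilizer_eq_pair hexp hT hnb ha1 hstab
  refine ⟨A ∪ A.image (fun s => s * a), hT, hnb, hpair, ?_⟩
  rw [two_mul_card_stabilizer_mul_eq_iff_card_eq_two hexp hT hnb, hpair, Finset.card_pair ha1.symm]

end Construction

/-! ## §4 Orders `4` and `16` have no primitive near-bent type; primitive ones need `|G| ≥ 64` -/

section Orders

/-- **ORDER `4`: every (near-bent) CM type `T = {t₁, t₂}` is stabilised by `t₁t₂ ≠ 1`, so `|Stab(T)| = 2`.**
[cite: Kubota1965, §2] [cite: Shimura1998, §8.4 Example (1)] -/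
theorem card_stabilizer_eq_two_of_card_eq_four (hexp : ∀ g : G, g ^ 2 = 1) (h : IsCMTypeWith ρ (T : Set G))
    (h4 : Fintype.card G = 4) :
    (Finset.univ.filter fun x : G => ∀ t : G, t * x ∈ T ↔ t ∈ T).card = 2 := by
  have hnb := nearBent_of_card_eq_four hexp h h4
  have hT : T.card = 2 := by have := two_mul_card_ns h; omega
  obtain ⟨t₁, t₂, hne, hT12⟩ := Finset.card_eq_two.1 hT
  have hg1 : t₁ * t₂ ≠ 1 := by
    intro h1
    apply hne
    have := mul_eq_one_iff_eq_inv.1 h1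
    rw [this, inv_eq_of_mul_eq_one_right (mul_self_eq_one_ns hexp t₂)]
  refine card_stabilizer_eq_two_of_forall_mul_mem_iff hexp h hnb hg1 fun t => ?_
  rw [hT12]
  simp only [Finset.mem_insert, Finset.mem_singleton]
  have h11 := mul_self_eq_one_ns hexp t₁
  have h22 := mul_self_eq_one_ns hexp t₂
  constructor
  · rintro (e | e)
    · right
      calc t = t * (t₁ * t₂) * (t₁ * t₂) := by
            rw [mul_assoc, show t₁ * t₂ * (t₁ * t₂) = (t₁ * t₁) * (t₂ * t₂) by
              simp only [mul_assoc, mul_left_comm t₂ t₁ t₂], h11, h22, mul_one, mul_one]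
        _ = t₂ := by rw [e, ← mul_assoc, h11, one_mul]
    · left
      calc t = t * (t₁ * t₂) * (t₁ * t₂) := by
            rw [mul_assoc, show t₁ * t₂ * (t₁ * t₂) = (t₁ * t₁) * (t₂ * t₂) by
              simp only [mul_assoc, mul_left_comm t₂ t₁ t₂], h11, h22, mul_one, mul_one]
        _ = t₁ := by rw [e, mul_comm t₁ t₂, ← mul_assoc, h22, one_mul]
  · rintro (e | e) <;> rw [e]
    · right
      rw [← mul_assoc, h11, one_mul]
    · left
      rw [mul_comm t₁ t₂, ← mul_assoc, h22, one_mul]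

/-- **ORDER `16`: EVERY NEAR-BENT TYPE HAS `|Stab(T)| = 2`** — near-bent ⟺ rank `5` (tree), and a rank-`5` type on an
elementary abelian `2`-group has `|G| ≤ 8·|Stab(T)|` (tree `card_le_eight_mul_card_filter_forall_mul_mem_iff_of_typeRank_eq_five`);
so all `112` near-bent types of order `16` are concatenations `f ‖ f` of the `8` bent types of order `8`.
[cite: Kubota1965, §4 Lemma 2] [cite: Carlet2020, §6.2.4] -/
theorem card_stabilizer_eq_two_of_card_eq_sixteen (hexp : ∀ g : G, g ^ 2 = 1) (h : IsCMTypeWith ρ (T : Set G))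
    (h16 : Fintype.card G = 16)
    (hnb : ∀ χ : AddChar (Additive G) ℂ, χ (Additive.ofMul ρ) = -1 →
      ∑ t ∈ T, χ (Additive.ofMul t) = 0 ∨ (∑ t ∈ T, χ (Additive.ofMul t)) ^ 2 = 2 * (T.card : ℂ)) :
    (Finset.univ.filter fun x : G => ∀ t : G, t * x ∈ T ↔ t ∈ T).card = 2 := by
  have h5 := (nearBent_iff_typeRank_eq_five_of_card_eq_sixteen hexp h h16).1 hnb
  have hge := card_le_eight_mul_card_filter_forall_mul_mem_iff_of_typeRank_eq_five hexp h h5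
  have hle := card_stabilizer_le_two hexp h hnb
  omega

/-- **ORDER `16`: every near-bent type is stabilised by some `g ≠ 1`** (and is then `A ∪ A·g`, `eq_union_image`).
[cite: Kubota1965, §2] [cite: Carlet2020, §6.2.4] -/
theorem exists_forall_mul_mem_iff_of_card_eq_sixteen (hexp : ∀ g : G, g ^ 2 = 1) (h : IsCMTypeWith ρ (T : Set G))
    (h16 : Fintype.card G = 16)
    (hnb : ∀ χ : AddChar (Additive G) ℂ, χ (Additive.ofMul ρ) = -1 →
      ∑ t ∈ T, χ (Additive.ofMul t) = 0 ∨ (∑ t ∈ T, χ (Additive.ofMul t)) ^ 2 = 2 * (T.card : ℂ)) :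
    ∃ g : G, g ≠ 1 ∧ ∀ t : G, t * g ∈ T ↔ t ∈ T := by
  have h2 := card_stabilizer_eq_two_of_card_eq_sixteen hexp h h16 hnb
  have hlt : 1 < (Finset.univ.filter fun x : G => ∀ t : G, t * x ∈ T ↔ t ∈ T).card := by omega
  obtain ⟨a, ha, b, hb, hab⟩ := Finset.one_lt_card.1 hlt
  by_cases ha1 : a = 1
  · refine ⟨b, fun hb1 => hab (by rw [ha1, hb1]), (Finset.mem_filter.1 hb).2⟩
  · exact ⟨a, ha1, (Finset.mem_filter.1 ha).2⟩

omit [DecidableEq G] in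
/-- A finite commutative group of exponent `2` with `ρ ≠ 1` whose order is a perfect square has order `4ᵏ⁺¹`.
[folklore] -/
private theorem exists_card_eq_four_pow_ns (hexp : ∀ g : G, g ^ 2 = 1) (hρ1 : ρ ≠ 1)
    (hsq : IsSquare (Fintype.card G)) : ∃ k : ℕ, Fintype.card G = 4 ^ (k + 1) := by
  haveI : Fact (Nat.Prime 2) := ⟨Nat.prime_two⟩
  have hP : IsPGroup 2 G := fun g => ⟨1, by rw [pow_one]; exact hexp g⟩
  obtain ⟨n, hn⟩ := IsPGroup.iff_card.1 hP
  rw [Nat.card_eq_fintype_card] at hn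
  have hn1 : n ≠ 0 := by
    rintro rfl
    rw [pow_zero] at hn
    exact hρ1 (Fintype.card_le_one_iff.1 hn.le ρ 1)
  rw [hn] at hsq
  obtain ⟨s, hs⟩ := hsq
  have hsd : s ∣ 2 ^ n := ⟨s, hs⟩
  obtain ⟨j, -, rfl⟩ := (Nat.dvd_prime_pow Nat.prime_two).1 hsd
  rw [← pow_add] at hs
  have hnj : n = j + j := Nat.pow_right_injective (le_refl 2) hs
  have hj : j ≠ 0 := by rintro rfl; exact hn1 hnj
  obtain ⟨k, rfl⟩ : ∃ k, j = k + 1 := ⟨j - 1, by omega⟩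
  refine ⟨k, ?_⟩
  have h4 : (4 : ℕ) ^ (k + 1) = 2 ^ (k + 1) * 2 ^ (k + 1) := by rw [← mul_pow]; norm_num
  rw [hn, hnj, pow_add, h4]

/-- **A PRIMITIVE NEAR-BENT TYPE NEEDS `|G| ≥ 64`** (five Boolean variables): `|G|` is a square `4ᵏ⁺¹`
(`isSquare_card`), and orders `4` and `16` have `|Stab| = 2` throughout. [cite: Kubota1965, §2 and §4 Lemma 2]
[cite: Carlet2020, §6.2.4] -/
theorem sixtyFour_le_card_of_card_stabilizer_eq_one (hexp : ∀ g : G, g ^ 2 = 1) (h : IsCMTypeWith ρ (T : Set G))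
    (hnb : ∀ χ : AddChar (Additive G) ℂ, χ (Additive.ofMul ρ) = -1 →
      ∑ t ∈ T, χ (Additive.ofMul t) = 0 ∨ (∑ t ∈ T, χ (Additive.ofMul t)) ^ 2 = 2 * (T.card : ℂ))
    (hprim : (Finset.univ.filter fun x : G => ∀ t : G, t * x ∈ T ↔ t ∈ T).card = 1) :
    64 ≤ Fintype.card G := by
  have hρ1 : ρ ≠ 1 := by
    intro hρ
    have := h.rho_smul_ne (1 : G)
    rw [hρ, smul_eq_mul, one_mul] at this
    exact this rfl
  obtain ⟨k, hk⟩ := exists_card_eq_four_pow_ns hexp hρ1 (isSquare_card hexp h hnb)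
  rcases k with _ | _ | k
  · have h2 := card_stabilizer_eq_two_of_card_eq_four hexp h (by rw [hk]; norm_num)
    omega
  · have h2 := card_stabilizer_eq_two_of_card_eq_sixteen hexp h (by rw [hk]; norm_num) hnb
    omega
  · rw [hk, pow_succ, pow_succ, pow_succ]
    have : 1 ≤ 4 ^ k := Nat.one_le_pow _ _ (by norm_num)
    omega

end Orders

end NearBentTypesStabilizer

end ExponentTwo

end CyclicCMType

end Literature.NumberTheory.ComplexMultiplication
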